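import Mathlib
import Summits.ResolutionOfSingularities.ResolutionOfSingularities.Theorems.RadicialJungCleanModelsDeficiencyNotPrincipal
import Literature.AlgebraicGeometry.Resolution.ExcellentRings
import HarnessLib

/-!
# Route `RadicialJung`, crux `CleanModels` (stmt-ResolutionOfSingularities-15917), line `Sketch` rev 35, stub 6 `stub_cleanProp44` (X44c),
# work plan O8 / L7b-global, residual (b): the DEFICIENCY SET of a non-`p`-th power on a one-dimensional J-2 domain is FINITE

Memo `Cruxes/CleanModels/Lines/Sketch-memo-hand2-g9-stubs-5-7.md` §3a/§3b «REMAINING (b): finiteness of the DEFICIENT points inside `W`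
when the generic type is (2) … the one non-mechanical point, O7 flavour».  It is settled here for EVERY one-dimensional Noetherian domain
`D` of characteristic `p` with the J-2 property (in particular every quasi-excellent, e.g. excellent, curve — no hypothesis on residue
fields, no `F`-finiteness, no derivation): if `v ∈ D` is not a `p`-th power in `Frac D`, the set of primes `𝔮` at which `v` is a `p`-th power
modulo `𝔮² D_𝔮` (`s^p v − e^p ∈ 𝔮²`, `s ∉ 𝔮`) is finite (`finite_setOf_deficient`).

Proof.  `E := D[x]/(x^p − v)` is a domain (it embeds in the field `Frac(D)[x]/(x^p − v)`, `x^p − v` being irreducible over `Frac D`),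
finite over `D`, hence one-dimensional; by J-2 its singular locus `Z` is closed, so its image in `Spec D` under the (closed) finite map is
closed; the image misses the generic point (the only prime of `E` over `(0)` is `(0)`, and `E_{(0)}` is a field), hence is contained in
`V(d)` for some `d ≠ 0`, a finite set of maximal ideals (minimal primes of `(d)`).  A deficient `𝔮` is maximal (`𝔮 ≠ 0` as `v ∉ Frac(D)^p`),
`𝔮 ≠ 𝔮²` (Krull), and by ✓ `not_isPrincipal_maximalIdeal_of_deficient` (`…DeficiencyNotPrincipal.lean`) every prime `𝔑` of `E` over `𝔮`
has `𝔪_{E_𝔑}` non-principal, so the one-dimensional local ring `E_𝔑` is not regular: `𝔮 ∈ image(Z)`.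

Honest framing: OURS (the observation «deficient ⟺ the radicial cover is singular above» turns the memo's O7-flavoured residual into a
consequence of quasi-excellence); nothing here proves X44c or any case of `CleanModels`.
-/

noncomputable section

set_option linter.dupNamespace false -- mandated namespace of this single-conjunct summit

open IsLocalRing Polynomial Literature.AlgebraicGeometry.Resolution

namespace Summit.ResolutionOfSingularities.ResolutionOfSingularities.Theorems.RadicialJung.CleanModels

universe u

/-- For a monic `f ∈ D[X]` and an injective `φ : D → F`, the natural map `D[x]/(f) → F[x]/(f)` is injective (division by the monic `f`). -/
theorem adjoinRoot_lift_map_injective {D F : Type u} [CommRing D] [CommRing F] (φ : D →+* F) (hφ : Function.Injective φ) {f : D[X]}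
    (hf : f.Monic) (hev : f.eval₂ ((AdjoinRoot.of (f.map φ)).comp φ) (AdjoinRoot.root (f.map φ)) = 0) :
    Function.Injective (AdjoinRoot.lift ((AdjoinRoot.of (f.map φ)).comp φ) (AdjoinRoot.root (f.map φ)) hev) := by
  rw [injective_iff_map_eq_zero]
  intro z hz
  obtain ⟨g, rfl⟩ := AdjoinRoot.mk_surjective z
  have h1 : AdjoinRoot.lift ((AdjoinRoot.of (f.map φ)).comp φ) (AdjoinRoot.root (f.map φ)) hev (AdjoinRoot.mk f g) =
      AdjoinRoot.mk (f.map φ) (g.map φ) := by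
    rw [AdjoinRoot.lift_mk, ← eval₂_map, ← AdjoinRoot.algebraMap_eq, ← aeval_def, AdjoinRoot.aeval_eq]
  rw [h1, AdjoinRoot.mk_eq_zero] at hz
  rw [AdjoinRoot.mk_eq_zero, ← Polynomial.modByMonic_eq_zero_iff_dvd hf]
  have h2 : (g %ₘ f).map φ = 0 := by
    rw [Polynomial.map_modByMonic φ hf, Polynomial.modByMonic_eq_zero_iff_dvd (hf.map φ)]; exact hz
  exact (Polynomial.map_eq_zero_iff hφ).mp h2

/-- `D[x]/(x^p − v)` is a domain when `D` is a domain and `v` is not a `p`-th power in `Frac D` (`s ≠ 0 ⟹ s^p v ≠ c^p`). -/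
theorem isDomain_adjoinRoot_X_pow_sub_C (p : ℕ) [hp : Fact p.Prime] {D : Type u} [CommRing D] [IsDomain D] (v : D)
    (hv : ∀ c s : D, s ≠ 0 → s ^ p * v ≠ c ^ p) {f : D[X]} (hfdef : f = X ^ p - C v) : IsDomain (AdjoinRoot f) := by
  classical
  have hp' : p.Prime := hp.out
  have hf : f.Monic := by rw [hfdef]; exact monic_X_pow_sub_C v hp'.ne_zero
  let F := FractionRing D
  set φ := algebraMap D F with hφ
  have hφinj : Function.Injective φ := IsFractionRing.injective D F
  have hirr : Irreducible (f.map φ) := by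
    rw [hfdef, Polynomial.map_sub, Polynomial.map_pow, map_X, map_C]
    refine X_pow_sub_C_irreducible_of_prime hp' fun b hb => ?_
    obtain ⟨c, s, hs, rfl⟩ := IsFractionRing.div_surjective (A := D) b
    have hs0 : (s : D) ≠ 0 := nonZeroDivisors.ne_zero hs
    have hsF : φ s ≠ 0 := (map_ne_zero_iff φ hφinj).mpr hs0
    refine hv c s hs0 (hφinj ?_)
    rw [div_pow, div_eq_iff (pow_ne_zero _ hsF)] at hb
    rw [map_mul, map_pow, map_pow, hb]
    ring
  haveI : Fact (Irreducible (f.map φ)) := ⟨hirr⟩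
  have hev : f.eval₂ ((AdjoinRoot.of (f.map φ)).comp φ) (AdjoinRoot.root (f.map φ)) = 0 := by
    rw [← eval₂_map, AdjoinRoot.eval₂_root]
  exact (adjoinRoot_lift_map_injective φ hφinj hf hev).isDomain _

/-- **Finiteness of the deficiency set.**  `D` a one-dimensional Noetherian domain of characteristic `p` with the J-2 property, `v ∈ D`
not a `p`-th power in `Frac D`.  Then the primes `𝔮` of `D` at which `v` is DEFICIENT (`s^p v − e^p ∈ 𝔮²` for some `s ∉ 𝔮`, i.e.
`v ∈ D_𝔮^p + 𝔮² D_𝔮`) form a finite set.  See the module docstring. [cite: Matsumura1987, §32 p. 260 Definition] [cite: StacksProject, Tag 07P7] -/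
theorem finite_setOf_deficient (p : ℕ) [hp : Fact p.Prime] {D : Type u} [CommRing D] [IsDomain D] [CharP D p] (hJ : IsJ2Ring D)
    [Ring.DimensionLEOne D] (v : D) (hv : ∀ c s : D, s ≠ 0 → s ^ p * v ≠ c ^ p) :
    {𝔮 : Ideal D | 𝔮.IsPrime ∧ ∃ s e : D, s ∉ 𝔮 ∧ s ^ p * v - e ^ p ∈ 𝔮 ^ 2}.Finite := by
  classical
  haveI : IsNoetherianRing D := hJ.1
  have hp' : p.Prime := hp.out
  set f : D[X] := X ^ p - C v with hfdef
  have hf : f.Monic := by rw [hfdef]; exact monic_X_pow_sub_C v hp'.ne_zero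
  haveI : Module.Finite D (AdjoinRoot f) := hf.finite_adjoinRoot
  haveI hint : Algebra.IsIntegral D (AdjoinRoot f) := inferInstance
  have hdegf : f.degree ≠ 0 := by rw [hfdef, degree_X_pow_sub_C hp'.pos]; exact_mod_cast hp'.ne_zero
  haveI : IsDomain (AdjoinRoot f) := isDomain_adjoinRoot_X_pow_sub_C p v hv hfdef
  have hinj : Function.Injective (algebraMap D (AdjoinRoot f)) := AdjoinRoot.of.injective_of_degree_ne_zero hdegf
  -- J-2: the singular locus `Z` of `E` is closed, and so is its image in `Spec D` (finite map)
  have hopen : IsOpen (regularLocus (AdjoinRoot f)) := hJ.2 (AdjoinRoot f) inferInstance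
  set Z : Set (PrimeSpectrum (AdjoinRoot f)) := (regularLocus (AdjoinRoot f))ᶜ with hZ
  have hZclosed : IsClosed Z := hopen.isClosed_compl
  have hintmap : (algebraMap D (AdjoinRoot f)).IsIntegral := algebraMap_isIntegral_iff.mpr hint
  have hWclosed : IsClosed (PrimeSpectrum.comap (algebraMap D (AdjoinRoot f)) '' Z) :=
    PrimeSpectrum.isClosedMap_comap_of_isIntegral _ hintmap Z hZclosed
  obtain ⟨t, ht⟩ := (PrimeSpectrum.isClosed_iff_zeroLocus _).mp hWclosed
  -- the generic point is not in the image: the only prime of `E` over `(0)` is `(0)`, and `E_(0)` is a field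
  have hbot : (⟨⊥, Ideal.isPrime_bot⟩ : PrimeSpectrum D) ∉ PrimeSpectrum.comap (algebraMap D (AdjoinRoot f)) '' Z := by
    rintro ⟨𝔑, h𝔑Z, h𝔑bot⟩
    apply h𝔑Z
    have h1 : 𝔑.asIdeal.comap (algebraMap D (AdjoinRoot f)) = ⊥ := congrArg PrimeSpectrum.asIdeal h𝔑bot
    have h2 : 𝔑.asIdeal = ⊥ := Ideal.eq_bot_of_comap_eq_bot h1
    change IsRegularLocalRing (Localization.AtPrime 𝔑.asIdeal)
    haveI : IsDomain (Localization.AtPrime 𝔑.asIdeal) :=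
      IsLocalization.isDomain_localization (Ideal.primeCompl_le_nonZeroDivisors _)
    have hF : IsField (Localization.AtPrime 𝔑.asIdeal) := by
      rw [IsLocalRing.isField_iff_maximalIdeal_eq, ← Localization.AtPrime.map_eq_maximalIdeal, Ideal.map_eq_bot_iff_le_ker]
      intro x hx
      rw [h2, Ideal.mem_bot] at hx
      rw [hx]; exact (RingHom.ker _).zero_mem
    letI := hF.toField
    infer_instance
  obtain ⟨d, hdt, hd0⟩ : ∃ d ∈ t, d ≠ 0 := by
    by_contra hcon
    push Not at hcon
    apply hbot
    rw [ht, PrimeSpectrum.mem_zeroLocus]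
    intro x hx
    have hx0 : x = 0 := hcon x hx
    rw [hx0]; exact Ideal.zero_mem _
  -- the primes containing `d ≠ 0` are the finitely many minimal primes of `(d)` (dimension ≤ 1)
  have hfin : {𝔮 : Ideal D | 𝔮.IsPrime ∧ d ∈ 𝔮}.Finite := by
    refine (Ideal.finite_minimalPrimes_of_isNoetherianRing D (Ideal.span {d})).subset fun 𝔮 h𝔮 => ?_
    obtain ⟨h𝔮p, hd𝔮⟩ := h𝔮
    have hle : Ideal.span {d} ≤ 𝔮 := (Ideal.span_singleton_le_iff_mem _).mpr hd𝔮
    refine ⟨⟨h𝔮p, hle⟩, fun P hP hP𝔮 => ?_⟩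
    obtain ⟨hPp, hdP⟩ := hP
    have hPne : P ≠ ⊥ := by
      rintro rfl
      exact hd0 (Ideal.mem_bot.mp (hdP (Ideal.mem_span_singleton_self d)))
    exact le_of_eq ((hPp.isMaximal hPne).eq_of_le h𝔮p.ne_top hP𝔮).symm
  -- every deficient prime lies in the image of `Z`
  refine hfin.subset ?_
  rintro 𝔮 ⟨h𝔮p, s, e, hs, hse⟩
  haveI := h𝔮p
  refine ⟨h𝔮p, ?_⟩
  have h𝔮ne : 𝔮 ≠ ⊥ := by
    rintro rfl
    have hs0 : s ≠ 0 := fun h => hs (by rw [h]; exact Ideal.zero_mem _)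
    rw [pow_two, Ideal.bot_mul, Ideal.mem_bot, sub_eq_zero] at hse
    exact hv e s hs0 hse
  have h𝔮max : 𝔮.IsMaximal := h𝔮p.isMaximal h𝔮ne
  -- `𝔮 ≠ 𝔮²` (Krull)
  obtain ⟨π, hπ, hπ2⟩ : ∃ π ∈ 𝔮, π ∉ 𝔮 ^ 2 := by
    by_contra hcon
    push Not at hcon
    have hsq : 𝔮 ≤ 𝔮 ^ 2 := hcon
    have hinf : (⨅ n : ℕ, 𝔮 ^ n) = ⊥ := Ideal.iInf_pow_eq_bot_of_isDomain 𝔮 h𝔮max.ne_top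
    apply h𝔮ne
    refine le_bot_iff.mp (le_trans (le_iInf fun n => ?_) (le_of_eq hinf))
    induction n with
    | zero => rw [pow_zero, Ideal.one_eq_top]; exact le_top
    | succ n ih =>
      calc 𝔮 ≤ 𝔮 ^ 2 := hsq
        _ = 𝔮 * 𝔮 := pow_two 𝔮
        _ ≤ 𝔮 ^ n * 𝔮 := Ideal.mul_mono_left ih
        _ = 𝔮 ^ (n + 1) := (pow_succ 𝔮 n).symm
  -- a prime `𝔑` of `E` over `𝔮`; there `E_𝔑` is one-dimensional with non-principal maximal ideal, hence singular
  obtain ⟨𝔑, -, h𝔑p, h𝔑𝔮⟩ := Ideal.exists_ideal_over_prime_of_isIntegral 𝔮 (⊥ : Ideal (AdjoinRoot f))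
    (by rw [Ideal.comap_bot_of_injective _ hinj]; exact bot_le)
  haveI := h𝔑p
  have h𝔑Z : (⟨𝔑, h𝔑p⟩ : PrimeSpectrum (AdjoinRoot f)) ∈ Z := by
    rw [hZ, Set.mem_compl_iff]
    intro hreg
    change IsRegularLocalRing (Localization.AtPrime 𝔑) at hreg
    have h𝔮max' : (𝔑.comap (algebraMap D (AdjoinRoot f))).IsMaximal := by rw [h𝔑𝔮]; exact h𝔮max
    refine not_isPrincipal_maximalIdeal_of_deficient p v hfdef 𝔑 h𝔮max' (s := s) (e := e) (π := π)
      (by rw [h𝔑𝔮]; exact hs) (by rw [h𝔑𝔮]; exact hse) (by rw [h𝔑𝔮]; exact hπ) (by rw [h𝔑𝔮]; exact hπ2) ?_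
    haveI : Ring.DimensionLEOne (AdjoinRoot f) := Ring.DimensionLEOne.of_isIntegral D (AdjoinRoot f)
    haveI : Ring.DimensionLEOne (Localization.AtPrime 𝔑) :=
      Ring.DimensionLEOne.localization (Localization.AtPrime 𝔑) (Ideal.primeCompl_le_nonZeroDivisors 𝔑)
    have hdim : ringKrullDim (Localization.AtPrime 𝔑) ≤ 1 := Ring.krullDimLE_iff.mp inferInstance
    have hsf := hreg.spanFinrank_maximalIdeal
    have hle1 : (maximalIdeal (Localization.AtPrime 𝔑)).spanFinrank ≤ 1 := by
      have h1 : ((maximalIdeal (Localization.AtPrime 𝔑)).spanFinrank : WithBot ℕ∞) ≤ 1 := by rw [hsf]; exact hdim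
      exact_mod_cast h1
    have hfg : (maximalIdeal (Localization.AtPrime 𝔑)).FG := IsNoetherian.noetherian _
    rcases Nat.le_one_iff_eq_zero_or_eq_one.mp hle1 with h0 | h1
    · rw [Submodule.spanFinrank_eq_zero_iff_eq_bot hfg] at h0
      rw [h0]; infer_instance
    · exact ((Submodule.spanFinrank_eq_one_iff _).mp h1).1
  have hmem : (⟨𝔮, h𝔮p⟩ : PrimeSpectrum D) ∈ PrimeSpectrum.comap (algebraMap D (AdjoinRoot f)) '' Z :=
    ⟨⟨𝔑, h𝔑p⟩, h𝔑Z, PrimeSpectrum.ext h𝔑𝔮⟩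
  rw [ht, PrimeSpectrum.mem_zeroLocus] at hmem
  exact hmem hdt

/-- The same over a **quasi-excellent** (e.g. excellent) one-dimensional domain. [cite: Matsumura1987, §32 p. 260 Definition] -/
theorem finite_setOf_deficient_of_isQuasiExcellentRing (p : ℕ) [Fact p.Prime] {D : Type u} [CommRing D] [IsDomain D] [CharP D p]
    (hD : IsQuasiExcellentRing D) [Ring.DimensionLEOne D] (v : D) (hv : ∀ c s : D, s ≠ 0 → s ^ p * v ≠ c ^ p) :
    {𝔮 : Ideal D | 𝔮.IsPrime ∧ ∃ s e : D, s ∉ 𝔮 ∧ s ^ p * v - e ^ p ∈ 𝔮 ^ 2}.Finite :=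
  finite_setOf_deficient p hD.2 v hv

/-- `PrimeSpectrum` form of `finite_setOf_deficient`. -/
theorem finite_setOf_deficient_primeSpectrum (p : ℕ) [Fact p.Prime] {D : Type u} [CommRing D] [IsDomain D] [CharP D p]
    (hJ : IsJ2Ring D) [Ring.DimensionLEOne D] (v : D) (hv : ∀ c s : D, s ≠ 0 → s ^ p * v ≠ c ^ p) :
    {𝔮 : PrimeSpectrum D | ∃ s e : D, s ∉ 𝔮.asIdeal ∧ s ^ p * v - e ^ p ∈ 𝔮.asIdeal ^ 2}.Finite := by
  refine ((finite_setOf_deficient p hJ v hv).preimage (f := PrimeSpectrum.asIdeal) ?_).subset ?_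
  · exact fun x _ y _ h => PrimeSpectrum.ext h
  · intro 𝔮 h𝔮
    exact ⟨𝔮.2, h𝔮⟩

end Summit.ResolutionOfSingularities.ResolutionOfSingularities.Theorems.RadicialJung.CleanModels

end
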